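import Literature.IUT.HodgeArakelov.LabelClassesOfCuspsCor24iOfSpecialFibreComap
import Literature.IUT.HodgeArakelov.LabelClassesOfCuspsCor24iLevelsBridge
import HarnessLib

/-!
# [IUTchII] Cor 2.4 (i), open-subgroup step (B): abc-iut-w5-d121's levels bridge WITHOUT dictionary hypotheses, at `Π_{v▶} := Π_v ∩ Π^tp_{X,ℍ}`

S. Mochizuki, *Inter-universal Teichmüller Theory II*, kurims manuscript (Dec. 2020), §2, Def 2.3 (i) p. 67, Cor 2.4 (i) pp. 69–71 (proof p. 70
l. −2 – p. 71 l. 3: «by applying the equivalence of [IUTchI], Corollary 2.3, (vi) … to the various finite index open subgroups of `Δ^±_v`, it follows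
that `γ' ∈ Δ̂^±_{v□}`»); *Inter-universal Teichmüller Theory I* (May 2020), §2, Cor 2.3 (ii)–(vi) pp. 47–48, Prop 2.4 (i) p. 50
[cite: Mochizuki2012, II Def 2.3 (i) p.67, II Cor 2.4 (i) pp.69–71; I Cor 2.3 (ii)–(vi) pp.47–48, I Prop 2.4 (i) p.50] (D-0012 claim key, status
disputed; every printed statement of the series is a HYPOTHESIS named by the tree's L5 predicates — nothing of the series is asserted).  abc-iut cell,
seat abc-iut-w5-d132 (gen 5); node **IUTchII:Cor2.4(i)** (CONE-BOARD claimant abc-iut-w4-d012), GAP-LEDGER **G-w4d012-2** (the open-subgroup step (B));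
by-name sequel to abc-iut-w5-d121's `StableCurveAgreement.h23vi_of_piHatLevelData'` (LabelClassesOfCuspsCor24iLevelsBridge) and this seat's
`piSubgraphDictionary_comap` / `subgraphDictionary_comap` (p437206), `cor24_i_ofSpecialFibre_comap` (p438242).  PROOF-ONLY (no `def`/`structure`/`instance`).

THE POINT.  abc-iut-w5-d121's bridge derives the binder `h23vi` (step (B)) from PER-LEVEL [IUTchI] §2 data on the `Π̂_{X_v}` side (levels `U'_i`
shrinking to `1`, vertex actions, `incD`/`blkD`/`stabD`) PLUS the two `ℍ`-dictionaries `DicPi : A.PiSubgraphDictionary H`, `Dic : A.SubgraphDictionary H`.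
At the decomposition subgroup CUT OUT BY THE DATUM, `H▶ := incl⁻¹(φ⁻¹ Π^tp_{X,ℍ})`, both dictionaries are this seat's THEOREMS (p437206) — so step (B)
at `H▶` needs ONLY the per-level data (+ [IUTchI] Cor 2.3 (iii), (iv) of the datum under `Cor23Hyp`, `Π_v ⊴ Π^±_v` of finite index).  Composed with
p438242, the landed predicate `Cor24_i W Cu H▶' I` at an agreement with abc-iut-L5's `ofSpecialFibre` follows from L5 NODES + per-level data ALONE:
no dictionary hypothesis, no `h23vi` hypothesis.

* **`StableCurveAgreement.h23vi_comap_of_piHatLevelData`** — step (B) `h23vi` at `H▶` from the per-level data (levels stated on the `Π̂_{X_v}` side),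
  for every agreement with bicontinuous `eHat` matched to `φ` on `Π^±_v`;
* **`StableCurveAgreement.cor24_i_ofSpecialFibre_comap_of_piHatLevelData`** — `Cor24_i W Cu H▶' I` at an agreement with `ofSpecialFibre X d Sf … TpH …`
  for the re-graphed `ℍ'` (`TpH'`): from [IUTchI] Prop 2.4 (i) of the datum; `Π̂_{ℍ'}` = closure of `Π^tp_{ℍ'}`; [IUTchI] Cor 2.3 (iii), (iv), (v) of the
  `ℍ'`-datum under its `Cor23Hyp`; `Π_v ⊴ Π^±_v` of finite index; and the PER-LEVEL data of the printed open-subgroup argument over the `ℍ'`-datum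
  (`U'`, `hbasis'`, `V`, `comp`, `c`, `base`, `incD`, `blkD`, `stabD` — HYPOTHESES, the L5 side of G-w4d012-2).

HONEST LABEL: the per-level inputs are the content of [IUTchI] Cor 2.3 (vi) / [CombGC] Prop 1.2 (ii) at the finite levels (GAP G-w4d012-2, L5 side) and
stay hypotheses; `H▶'` ↔ `SubgraphDecomposition.Ptri` is the MERGE identification, NOT claimed.  Nothing of the series is asserted; no side taken on
[IUTchIII] Cor 3.12.
-/

noncomputable section

namespace Literature.IUT.HodgeArakelov

open Literature.AnabelianGeometry.EtaleTheta Literature.AnabelianGeometry.SemiGraphs Literature.IUT.HodgeTheaters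
open _root_.Topology
open scoped Pointwise

namespace PlusMinusTower

namespace StableCurveAgreement

section Generic

universe u

variable {S : BadPlaceSetting.{u}} {P : TopGroup.{u}} {T : TemperedCoverings S P}
  {W : PlusMinusTower T} {C : CuspidalInertiaData W} {D : StableCurveTemperedData.{u}}

/-- **IUTchII:Cor2.4(i)** (kurims p.70 l.−2 – p.71 l.3) **Step (B) `h23vi` AT `H▶ := incl⁻¹(φ⁻¹ Π^tp_{X,ℍ})` from per-level data ALONE.**  abc-iut-w5-d121's
`h23vi_of_piHatLevelData'` with its two dictionary inputs `DicPi`, `Dic` DISCHARGED by `piSubgraphDictionary_comap` / `subgraphDictionary_comap`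
(p437206): for every agreement `A` with bicontinuous `eHat` matched to `φ` on `Π^±_v`, `Π_v ⊴ Π^±_v` of finite index, [IUTchI] Cor 2.3 (iii), (iv) of `D`
under `Cor23Hyp` (BY NAME), and the per-level data (`U'` shrinking to `1` in `Π̂_{X_v}`, vertex actions `V`, components `comp ∋ c`, `incD`, `blkD`, `stabD`
— HYPOTHESES): for `γ' ∈ Δ^±_v`, `I^{γ'} ⊆ Π^±_{v▶}` ⟹ `γ' ∈` closure of `Δ^±_{v▶}`.  PROVED. [claim: Mochizuki2012, status: disputed] -/
theorem h23vi_comap_of_piHatLevelData (A : StableCurveAgreement W C D) (hA : IsHomeomorph A.eHat)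
    (φ : T.Xplain ≃* D.PiTp)
    (hφ : ∀ x : T.Xplain, A.eHat ⟨W.emb x, W.emb_le_pmHat ⟨x, rfl⟩⟩ = D.ιX (φ x))
    (hN : T.incl.range.Normal) (hI : T.incl.range.index ≠ 0) (hHyp : D.Cor23Hyp) (h23iii : D.Cor23iii)
    (h23iv : D.Cor23iv) {I : Subgroup W.Corhat}
    {ι : Sort*} (U' : ι → Subgroup D.PiHat) (hbasis' : ∀ O' ∈ 𝓝 (1 : D.PiHat), ∃ i, (U' i : Set D.PiHat) ⊆ O')
    (V : ι → Type*) [∀ i, MulAction D.PiHat (V i)] (comp : ∀ i, Set (V i)) (c : ∀ i, V i)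
    (base : ∀ i, c i ∈ comp i)
    (incD : ∀ i (g' : D.PiHat), g' ∈ D.ιX.range → g' ∈ D.DeltaHat →
      MulAut.conj g' • ((I.subgroupOf W.pmHat).map A.eHat.toMonoidHom) ≤ D.piTpXH.map D.ιX → g' • c i ∈ comp i)
    (blkD : ∀ i (g' : D.PiHat), g' ∈ D.ιX.range → g' ∈ D.DeltaHat →
      (∃ v ∈ comp i, g' • v ∈ comp i) → ∀ v ∈ comp i, g' • v ∈ comp i)
    (stabD : ∀ i (g' : D.PiHat), g' ∈ D.ιX.range → g' ∈ D.DeltaHat →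
      (∀ v ∈ comp i, g' • v ∈ comp i) →
        ∃ k' ∈ (D.deltaTpH.map D.ιΔ).map D.DeltaHat.subtype, k'⁻¹ * g' ∈ U' i) :
    ∀ γ' : W.Corhat, γ' ∈ W.piPM ⊓ W.aug.ker →
      I.map (MulAut.conj γ').toMonoidHom ≤ W.pmBox ((D.piTpXH.comap φ.toMonoidHom).comap T.incl) →
        γ' ∈ closure (W.deltaPmBox ((D.piTpXH.comap φ.toMonoidHom).comap T.incl) : Set W.Corhat) :=
  A.h23vi_of_piHatLevelData' (A.piSubgraphDictionary_comap hA φ hφ hN hI hHyp h23iv)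
    (A.subgraphDictionary_comap hA φ hφ hN hI hHyp h23iii h23iv) U' hbasis' V comp c base incD blkD stabD

end Generic

section OfSpecialFibre

variable {S : BadPlaceSetting.{0}} {P : TopGroup.{0}} {T : TemperedCoverings S P} {W : PlusMinusTower T}
  {Cu : CuspidalInertiaData W}
  {p : ℕ} [Fact p.Prime] {X : TemperedCurve p} {d : X.GroupLevelData}
  {Sf : SpecialFibreData (X.toTemperedArithmeticGroup d)} {h36 : Sf.Gc.Prop36Hypotheses}
  {Sigma SigmaHat : Set ℕ} {hsub : Sigma ⊆ SigmaHat} {hne : Sigma.Nonempty}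
  {hprime : ∀ q ∈ SigmaHat, q.Prime} {hp : p ∉ Sigma} {TpH : Subgroup Sf.chart.G}
  {HatH : Subgroup (TemperedGraphGroupData.exists_completion_of_prop36 Sf.Gc h36 Sf.chart).choose}
  {hle : TpH.map (TemperedGraphGroupData.exists_completion_of_prop36 Sf.Gc h36
    Sf.chart).choose_spec.choose.toMonoidHom ≤ HatH}
  {cMH : {x : X.Pt // X.IsCusp x} → Prop}

/-- **[IUTchII] Cor 2.4 (i) (the landed predicate `Cor24_i W Cu H▶' I`) at an agreement with a special-fibre datum, from L5 NODES + PER-LEVEL DATA ALONE.**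
For a `Π_v`-cuspidal `I ⊆ Δ̂^cor_v` and the decomposition subgroup `H▶' := incl⁻¹(φ⁻¹ Π^tp_{X,ℍ'})` of a re-graphing sub-graph `ℍ'` (`TpH'`): `Cor24_i W Cu H▶' I`
from [IUTchI] Prop 2.4 (i) of the datum (input (A), abc-iut-w4-d012), `Π̂_{ℍ'}` = closure of `Π^tp_{ℍ'}` (`hH'`), [IUTchI] Cor 2.3 (iii), (iv), (v) of the
`ℍ'`-datum under its `Cor23Hyp`, `Π_v ⊴ Π^±_v` of finite index, and the PER-LEVEL data of the printed open-subgroup argument over the `ℍ'`-datum (step (B),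
abc-iut-w5-d121's bridge; HYPOTHESES = the L5 side of G-w4d012-2).  NO dictionary hypothesis (`subgraphDictionary_comap`), NO `h23vi` hypothesis
(`h23vi_comap_of_piHatLevelData`).  PROVED. ([IUTchII] Cor 2.4 (i), kurims pp.69–71) [claim: Mochizuki2012, status: disputed] -/
theorem cor24_i_ofSpecialFibre_comap_of_piHatLevelData
    (hlev : ∀ (Q I : Subgroup W.Corhat), Cu.IsCuspidalInertia Q I ↔
      I ≤ Q ∧ ∃ I₀ : Subgroup W.Corhat, Cu.IsCuspidalInertia W.piPM I₀ ∧ I = I₀ ⊓ Q)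
    (A : StableCurveAgreement W Cu (StableCurveTemperedData.ofSpecialFibre X d Sf h36 Sigma SigmaHat hsub hne hprime hp TpH HatH hle cMH))
    (hA : IsHomeomorph A.eHat)
    (φ : T.Xplain ≃* (StableCurveTemperedData.ofSpecialFibre X d Sf h36 Sigma SigmaHat hsub hne hprime hp TpH HatH hle cMH).PiTp)
    (hφ : ∀ x : T.Xplain, A.eHat ⟨W.emb x, W.emb_le_pmHat ⟨x, rfl⟩⟩ = (StableCurveTemperedData.ofSpecialFibre X d Sf h36 Sigma SigmaHat hsub hne hprime hp TpH HatH hle cMH).ιX (φ x))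
    (hN : T.incl.range.Normal) (hI : T.incl.range.index ≠ 0)
    (h24i : (StableCurveTemperedData.ofSpecialFibre X d Sf h36 Sigma SigmaHat hsub hne hprime hp TpH HatH hle cMH).Prop24i)
    {I : Subgroup W.Corhat} (hIc : Cu.IsCuspidalInertia W.piV I) (hIker : I ≤ W.aug.ker)
    (TpH' : Subgroup Sf.chart.G)
    (HatH' : Subgroup (TemperedGraphGroupData.exists_completion_of_prop36 Sf.Gc h36 Sf.chart).choose)
    (hle' : TpH'.map (TemperedGraphGroupData.exists_completion_of_prop36 Sf.Gc h36
      Sf.chart).choose_spec.choose.toMonoidHom ≤ HatH')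
    (cMH' : {x : X.Pt // X.IsCusp x} → Prop)
    (hH' : ((StableCurveTemperedData.ofSpecialFibre X d Sf h36 Sigma SigmaHat hsub hne hprime hp TpH' HatH' hle' cMH').graph.HatH : Set (StableCurveTemperedData.ofSpecialFibre X d Sf h36 Sigma SigmaHat hsub hne hprime hp TpH' HatH' hle' cMH').graph.Hat) = closure ((StableCurveTemperedData.ofSpecialFibre X d Sf h36 Sigma SigmaHat hsub hne hprime hp TpH' HatH' hle' cMH').graph.ι '' (StableCurveTemperedData.ofSpecialFibre X d Sf h36 Sigma SigmaHat hsub hne hprime hp TpH' HatH' hle' cMH').graph.TpH))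
    (hHyp' : (StableCurveTemperedData.ofSpecialFibre X d Sf h36 Sigma SigmaHat hsub hne hprime hp TpH' HatH' hle' cMH').Cor23Hyp) (h23iii' : (StableCurveTemperedData.ofSpecialFibre X d Sf h36 Sigma SigmaHat hsub hne hprime hp TpH' HatH' hle' cMH').Cor23iii) (h23iv' : (StableCurveTemperedData.ofSpecialFibre X d Sf h36 Sigma SigmaHat hsub hne hprime hp TpH' HatH' hle' cMH').Cor23iv) (h23v' : (StableCurveTemperedData.ofSpecialFibre X d Sf h36 Sigma SigmaHat hsub hne hprime hp TpH' HatH' hle' cMH').Cor23v)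
    {ι : Sort*} (U' : ι → Subgroup (StableCurveTemperedData.ofSpecialFibre X d Sf h36 Sigma SigmaHat hsub hne hprime hp TpH' HatH' hle' cMH').PiHat) (hbasis' : ∀ O' ∈ 𝓝 (1 : (StableCurveTemperedData.ofSpecialFibre X d Sf h36 Sigma SigmaHat hsub hne hprime hp TpH' HatH' hle' cMH').PiHat), ∃ i, (U' i : Set (StableCurveTemperedData.ofSpecialFibre X d Sf h36 Sigma SigmaHat hsub hne hprime hp TpH' HatH' hle' cMH').PiHat) ⊆ O')
    (V : ι → Type*) [∀ i, MulAction (StableCurveTemperedData.ofSpecialFibre X d Sf h36 Sigma SigmaHat hsub hne hprime hp TpH' HatH' hle' cMH').PiHat (V i)] (comp : ∀ i, Set (V i)) (c : ∀ i, V i)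
    (base : ∀ i, c i ∈ comp i)
    (incD : ∀ i (g' : (StableCurveTemperedData.ofSpecialFibre X d Sf h36 Sigma SigmaHat hsub hne hprime hp TpH' HatH' hle' cMH').PiHat), g' ∈ (StableCurveTemperedData.ofSpecialFibre X d Sf h36 Sigma SigmaHat hsub hne hprime hp TpH' HatH' hle' cMH').ιX.range → g' ∈ (StableCurveTemperedData.ofSpecialFibre X d Sf h36 Sigma SigmaHat hsub hne hprime hp TpH' HatH' hle' cMH').DeltaHat →
      MulAut.conj g' • ((I.subgroupOf W.pmHat).map A.eHat.toMonoidHom) ≤ (StableCurveTemperedData.ofSpecialFibre X d Sf h36 Sigma SigmaHat hsub hne hprime hp TpH' HatH' hle' cMH').piTpXH.map (StableCurveTemperedData.ofSpecialFibre X d Sf h36 Sigma SigmaHat hsub hne hprime hp TpH' HatH' hle' cMH').ιX → g' • c i ∈ comp i)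
    (blkD : ∀ i (g' : (StableCurveTemperedData.ofSpecialFibre X d Sf h36 Sigma SigmaHat hsub hne hprime hp TpH' HatH' hle' cMH').PiHat), g' ∈ (StableCurveTemperedData.ofSpecialFibre X d Sf h36 Sigma SigmaHat hsub hne hprime hp TpH' HatH' hle' cMH').ιX.range → g' ∈ (StableCurveTemperedData.ofSpecialFibre X d Sf h36 Sigma SigmaHat hsub hne hprime hp TpH' HatH' hle' cMH').DeltaHat →
      (∃ v ∈ comp i, g' • v ∈ comp i) → ∀ v ∈ comp i, g' • v ∈ comp i)
    (stabD : ∀ i (g' : (StableCurveTemperedData.ofSpecialFibre X d Sf h36 Sigma SigmaHat hsub hne hprime hp TpH' HatH' hle' cMH').PiHat), g' ∈ (StableCurveTemperedData.ofSpecialFibre X d Sf h36 Sigma SigmaHat hsub hne hprime hp TpH' HatH' hle' cMH').ιX.range → g' ∈ (StableCurveTemperedData.ofSpecialFibre X d Sf h36 Sigma SigmaHat hsub hne hprime hp TpH' HatH' hle' cMH').DeltaHat →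
      (∀ v ∈ comp i, g' • v ∈ comp i) →
        ∃ k' ∈ ((StableCurveTemperedData.ofSpecialFibre X d Sf h36 Sigma SigmaHat hsub hne hprime hp TpH' HatH' hle' cMH').deltaTpH.map (StableCurveTemperedData.ofSpecialFibre X d Sf h36 Sigma SigmaHat hsub hne hprime hp TpH' HatH' hle' cMH').ιΔ).map (StableCurveTemperedData.ofSpecialFibre X d Sf h36 Sigma SigmaHat hsub hne hprime hp TpH' HatH' hle' cMH').DeltaHat.subtype, k'⁻¹ * g' ∈ U' i) :
    Literature.IUT.HodgeArakelov.Cor24_i W Cu (((StableCurveTemperedData.ofSpecialFibre X d Sf h36 Sigma SigmaHat hsub hne hprime hp TpH' HatH' hle' cMH').piTpXH.comap φ.toMonoidHom).comap T.incl) I :=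
  A.cor24_i_ofSpecialFibre_comap hlev hA φ hφ hN hI h24i hIc hIker TpH' HatH' hle' cMH' hH' hHyp' h23iii' h23iv' h23v'
    (h23vi_comap_of_piHatLevelData (D := (StableCurveTemperedData.ofSpecialFibre X d Sf h36 Sigma SigmaHat hsub hne hprime hp TpH' HatH' hle' cMH'))
      { eHat := A.eHat, map_piPM := A.map_piPM, mem_ker_iff := A.mem_ker_iff, inertia_iff := A.inertia_iff }
      hA φ hφ hN hI hHyp' h23iii' h23iv' U' hbasis' V comp c base incD blkD stabD)

end OfSpecialFibre

end StableCurveAgreement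

end PlusMinusTower

end Literature.IUT.HodgeArakelov

end
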